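import Mathlib.Analysis.Normed.Affine.Isometry
import Mathlib.Analysis.Real.Sqrt
import Literature.Geometry.DiscreteGeometry.BondGraph
import Literature.MathematicalPhysics.StatisticalMechanics.BarlowRings
import Literature.MathematicalPhysics.StatisticalMechanics.MuGroundStateConfiguration
import HarnessLib

/-!
# `ChargedEnergyGap` (stmt-AtomisticToContinuum-14231), line `defect-zoom-compactness`:
# the margin lemma — a locally Barlow root is neither charged nor at the bond threshold

Stub `stub_barlowMargin` of the line.  Let `Y ⊆ ℝ³` contain `0`, and suppose that on the ball
`‖·‖ ≤ 6a` the set `Y` is `a/2`-separated and two-way `a/800`-matched (`BallMatch`) to a rigid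
image `g '' barlowStacking a (a√(2/3)) s` of an IDEAL close-packed Barlow stacking (`g` an affine
isometry, `s` any Hägg sequence).  Then, for the configuration `Subtype.val : Y → ℝ³`, the site
`0` is charge-free at tolerance `1/100` (`IsChargeFree`: twelve bonds, ring number four across
each), and no two points of `Y` within `3 · nn_0` of `0` sit exactly at the bond threshold
`dist p p' = 1.01 · min (nn_p, nn_p')`.

Proof: the `ε = a/800` perturbation of the `ε = 0` computation for the ideal stacking
(`ChargedEnergyGapNegative.Barlow.isChargeFree_barlowStacking`), in the packaging of the landed
detection step `BarlowRelativePricingDetect` (matching maps `zOf`/`jOf`, round trips `jOf_zOf`,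
`zOf_jOf`).  Matched points move by `≤ a/800`, pair distances by `≤ a/400`: two distinct sites of
the ball are `≤ a + a/400` apart (their stacking points touch) or `≥ √2·a − a/400` apart (the
distance gap `(a, √2·a)`, `eq_or_dist_eq_of_dist_lt`), `dist_le_or_le`; every site within `4a` of
the centre has `a − a/400 ≤ nn ≤ a + a/400`.  Hence bonds at the centre and between its neighbours
are exactly the touching pairs (`1.0025 ≤ 1.01 · 0.9975`, `1.01 · 1.0025 + 0.0025 < 1.41 < √2`):
`N(0)` is the injective image of the twelve touching points (`ncard_touching_eq_twelve`),
`N(0) ∩ N(j_w)` that of the four common touching points (`ncard_commonTouching_eq_four`); and a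
threshold pair would have `dist ∈ [1.01 · 0.9975, 1.01 · 1.0025]·a ⊆ (1.0025·a, √2·a − 0.0025·a)`,
impossible (`not_threshold`).  Lemmas are stated for a general index type, scale `a > 0` and
layer spacing `h`, `h² = ⅔a²`; the stub specialises to centre `0`, `h = a√(2/3)`.
All `[folklore]`.
-/

namespace Summit.AtomisticToContinuum.Crystallization.Theorems.DefectZoomCompactnessBarlowMargin

open Literature.MathematicalPhysics.StatisticalMechanics Literature.Geometry.DiscreteGeometry

variable {ι : Type*} {y : ι → EuclideanSpace ℝ (Fin 3)} {i : ι} {a h : ℝ} {s : ℤ → ℤ}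
  {g : EuclideanSpace ℝ (Fin 3) ≃ᵃⁱ[ℝ] EuclideanSpace ℝ (Fin 3)}
  {zOf : ι → EuclideanSpace ℝ (Fin 3)} {jOf : EuclideanSpace ℝ (Fin 3) → ι}

/-- Some point of the ideal stacking touches `z` (there are twelve). [folklore] -/
theorem exists_touching (hs : IsHaggSeq s) (ha : 0 < a) (hh : h ^ 2 = 2 / 3 * a ^ 2)
    {z : EuclideanSpace ℝ (Fin 3)} (hz : z ∈ barlowStacking a h s) :
    ∃ w ∈ barlowStacking a h s, dist z w = a := by
  obtain ⟨w, hw, hd⟩ := Set.nonempty_of_ncard_ne_zero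
    (s := {w | w ∈ barlowStacking a h s ∧ dist z w = a})
    (by rw [ncard_touching_eq_twelve hs ha hh hz]; norm_num); exact ⟨w, hw, hd⟩

section Matching

variable (hs : IsHaggSeq s) (ha : 0 < a) (hh : h ^ 2 = 2 / 3 * a ^ 2)
  (hsep : ∀ j k : ι, j ≠ k → dist (y i) (y j) ≤ 6 * a → dist (y i) (y k) ≤ 6 * a →
    a / 2 ≤ dist (y j) (y k))
  (hz : ∀ j : ι, dist (y i) (y j) ≤ 6 * a →
    zOf j ∈ barlowStacking a h s ∧ dist (y j) (g (zOf j)) ≤ a / 800)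
  (hj : ∀ z ∈ barlowStacking a h s, dist (y i) (g z) ≤ 6 * a →
    dist (y (jOf z)) (g z) ≤ a / 800)

include hsep in
/-- Two sites of the ball `< a/2` apart coincide (the separation clause). [folklore] -/
theorem eq_of_dist_lt_half {j k : ι} (hjb : dist (y i) (y j) ≤ 6 * a)
    (hkb : dist (y i) (y k) ≤ 6 * a) (hlt : dist (y j) (y k) < a / 2) : j = k :=
  by_contra fun hne => absurd hlt (not_lt.2 (hsep j k hne hjb hkb))

include ha hsep hz hj in
/-- Round trip site → stacking point → site, in the ball of radius `5a`. [folklore] -/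
theorem jOf_zOf {j : ι} (hjb : dist (y i) (y j) ≤ 5 * a) : jOf (zOf j) = j := by
  have hj6 : dist (y i) (y j) ≤ 6 * a := by linarith
  obtain ⟨hzS, hzj⟩ := hz j hj6
  have htri := dist_triangle (y i) (y j) (g (zOf j))
  have hk := hj _ hzS (by linarith)
  refine eq_of_dist_lt_half hsep ?_ hj6 ?_
  · have := dist_triangle_right (y i) (y (jOf (zOf j))) (g (zOf j)); linarith
  · have := dist_triangle_right (y (jOf (zOf j))) (y j) (g (zOf j)); linarith

include hs ha hh hz hj in
/-- Round trip stacking point → site → stacking point, for stacking points within `5a` of the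
centre (distinct points of the ideal stacking are `≥ a` apart). [folklore] -/
theorem zOf_jOf {z : EuclideanSpace ℝ (Fin 3)} (hzS : z ∈ barlowStacking a h s)
    (hd : dist (y i) (g z) ≤ 5 * a) : zOf (jOf z) = z := by
  have hjz := hj z hzS (by linarith)
  have hij : dist (y i) (y (jOf z)) ≤ 6 * a := by
    have := dist_triangle_right (y i) (y (jOf z)) (g z); linarith
  obtain ⟨hz'S, hz'⟩ := hz _ hij
  by_contra hne
  have hle := le_dist_of_mem_barlowStacking_ideal hs ha hh hz'S hzS hne
  rw [← g.dist_map] at hle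
  have := dist_triangle_left (g (zOf (jOf z))) (g z) (y (jOf z))
  linarith

include hs ha hh hsep hz in
/-- Two distinct sites of the ball are `≥ a − a/400` apart (their stacking points are distinct,
hence `≥ a` apart). [folklore] -/
theorem le_dist_of_ne {j k : ι} (hne : j ≠ k) (hjb : dist (y i) (y j) ≤ 6 * a)
    (hkb : dist (y i) (y k) ≤ 6 * a) : a - a / 400 ≤ dist (y j) (y k) := by
  obtain ⟨hzjS, hzj⟩ := hz j hjb
  obtain ⟨hzkS, hzk⟩ := hz k hkb
  have hne' : zOf j ≠ zOf k := by
    intro heq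
    refine hne (eq_of_dist_lt_half hsep hjb hkb ?_)
    rw [heq] at hzj
    have := dist_triangle_right (y j) (y k) (g (zOf k)); linarith
  have hle := le_dist_of_mem_barlowStacking_ideal hs ha hh hzjS hzkS hne'
  rw [← g.dist_map] at hle
  have h1 := dist_triangle (g (zOf j)) (y j) (g (zOf k))
  have h2 := dist_triangle (y j) (y k) (g (zOf k))
  linarith [dist_comm (y j) (g (zOf j))]

include hs ha hh hsep hz in
/-- **The perturbed distance gap**: two distinct sites of the ball are either `≤ a + a/400` apart
(their stacking points touch) or `≥ √2·a − a/400` apart. [folklore] -/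
theorem dist_le_or_le {j k : ι} (hne : j ≠ k) (hjb : dist (y i) (y j) ≤ 6 * a)
    (hkb : dist (y i) (y k) ≤ 6 * a) :
    dist (y j) (y k) ≤ a + a / 400 ∨ Real.sqrt 2 * a - a / 400 ≤ dist (y j) (y k) := by
  obtain ⟨hzjS, hzj⟩ := hz j hjb
  obtain ⟨hzkS, hzk⟩ := hz k hkb
  have h1 := dist_triangle (g (zOf j)) (y j) (g (zOf k))
  have h2 := dist_triangle (y j) (y k) (g (zOf k))
  have h3 := dist_triangle (y j) (g (zOf j)) (y k)
  have h4 := dist_triangle (g (zOf j)) (g (zOf k)) (y k)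
  rw [dist_comm (g (zOf j)) (y j)] at h1
  rcases lt_or_ge (dist (zOf j) (zOf k)) (Real.sqrt 2 * a) with hlt | hge
  · rcases eq_or_dist_eq_of_dist_lt hs ha hh hzjS hzkS hlt with heq | hdist
    · exfalso
      refine hne (eq_of_dist_lt_half hsep hjb hkb ?_)
      rw [heq] at hzj
      have := dist_triangle_right (y j) (y k) (g (zOf k)); linarith
    · left
      rw [← g.dist_map (zOf j) (zOf k)] at hdist
      linarith [dist_comm (y k) (g (zOf k))]
  · right
    rw [← g.dist_map (zOf j) (zOf k)] at hge
    linarith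

include hs ha hh hz hj in
/-- Every site within `4a` of the centre has another site within `a + a/400` (the site of a
stacking point touching its own stacking point). [folklore] -/
theorem exists_near {j : ι} (hjb : dist (y i) (y j) ≤ 4 * a) :
    ∃ k, k ≠ j ∧ dist (y j) (y k) ≤ a + a / 400 := by
  obtain ⟨hzS, hzj⟩ := hz j (by linarith)
  obtain ⟨w, hwS, hw⟩ := exists_touching hs ha hh hzS
  have hgw : dist (g (zOf j)) (g w) = a := by rw [g.dist_map, hw]
  have hk := hj w hwS (by
    linarith [dist_triangle (y i) (y j) (g w), dist_triangle (y j) (g (zOf j)) (g w)])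
  refine ⟨jOf w, fun heq => ?_, ?_⟩
  · rw [heq] at hk
    linarith [dist_comm (y j) (g (zOf j)), dist_triangle (g (zOf j)) (y j) (g w)]
  · have h1 := dist_triangle (y j) (g (zOf j)) (y (jOf w))
    have h2 := dist_triangle (g (zOf j)) (g w) (y (jOf w))
    linarith [dist_comm (g w) (y (jOf w))]

include hs ha hh hz hj in
/-- Upper scale bound near the centre: `nn_j ≤ a + a/400` for `j` within `4a`. [folklore] -/
theorem nearestDist_le_of_mem {j : ι} (hjb : dist (y i) (y j) ≤ 4 * a) :
    nearestDist y j ≤ a + a / 400 := by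
  obtain ⟨k, hk, hd⟩ := exists_near hs ha hh hz hj hjb
  exact (nearestDist_le_dist y hk).trans hd

include hs ha hh hsep hz hj in
/-- Lower scale bound near the centre: `a − a/400 ≤ nn_j` for `j` within `4a` (sites of the ball
by `le_dist_of_ne`, sites outside the ball are `≥ 2a` away). [folklore] -/
theorem le_nearestDist_of_mem {j : ι} (hjb : dist (y i) (y j) ≤ 4 * a) :
    a - a / 400 ≤ nearestDist y j := by
  obtain ⟨k₀, hk₀, -⟩ := exists_near hs ha hh hz hj hjb
  refine le_nearestDist ⟨k₀, hk₀⟩ fun k hk => ?_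
  by_cases hkb : dist (y i) (y k) ≤ 6 * a
  · exact le_dist_of_ne hs ha hh hsep hz (Ne.symm hk) (by linarith) hkb
  · linarith [lt_of_not_ge hkb, dist_triangle (y i) (y j) (y k)]

include ha hz hj in
/-- For a stacking point `w` touching the centre's stacking point `zOf i`: `g w` is within
`a + a/800` of `y i`, its site `jOf w` is `a/800`-close to `g w`, within `a + a/400` of `y i`,
and is not `i`. [folklore] -/
theorem touching_site {w : EuclideanSpace ℝ (Fin 3)} (hwS : w ∈ barlowStacking a h s)
    (hw : dist (zOf i) w = a) :
    dist (y i) (g w) ≤ a + a / 800 ∧ dist (y (jOf w)) (g w) ≤ a / 800 ∧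
      dist (y i) (y (jOf w)) ≤ a + a / 400 ∧ jOf w ≠ i := by
  obtain ⟨-, h0⟩ := hz i (by rw [dist_self]; linarith)
  have h1 : dist (y i) (g w) ≤ a + a / 800 := by
    have := dist_triangle (y i) (g (zOf i)) (g w)
    rw [g.dist_map, hw] at this
    linarith
  have h2 := hj w hwS (by linarith)
  have h3 : dist (y i) (y (jOf w)) ≤ a + a / 400 := by
    have := dist_triangle_right (y i) (y (jOf w)) (g w); linarith
  refine ⟨h1, h2, h3, fun heq => ?_⟩
  rw [heq] at h2
  have := dist_triangle_left (g (zOf i)) (g w) (y i)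
  rw [g.dist_map, hw] at this
  linarith

include hs ha hh hz hj in
/-- Touching stacking points are matched injectively. [folklore] -/
theorem injOn_jOf : Set.InjOn jOf {w | w ∈ barlowStacking a h s ∧ dist (zOf i) w = a} := by
  intro w hw w' hw' heq
  have hb : ∀ {v}, v ∈ barlowStacking a h s → dist (zOf i) v = a → dist (y i) (g v) ≤ 5 * a :=
    fun hvS hv => by linarith [(touching_site ha hz hj hvS hv).1]
  calc w = zOf (jOf w) := (zOf_jOf hs ha hh hz hj hw.1 (hb hw.1 hw.2)).symm
    _ = zOf (jOf w') := by rw [heq]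
    _ = w' := zOf_jOf hs ha hh hz hj hw'.1 (hb hw'.1 hw'.2)

include hs ha hh hsep hz hj in
/-- **The sites of the touching stacking points are bonded to the centre**
(`dist ≤ 1.0025·a ≤ 1.01 · 0.9975·a ≤ 1.01 · min (nn, nn)`). [folklore] -/
theorem jOf_mem_neighborSet {w : EuclideanSpace ℝ (Fin 3)} (hwS : w ∈ barlowStacking a h s)
    (hw : dist (zOf i) w = a) : jOf w ∈ (bondGraph (1 / 100 : ℝ) y).neighborSet i := by
  obtain ⟨-, -, hij, hne⟩ := touching_site ha hz hj hwS hw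
  rw [mem_neighborSet_bondGraph]
  refine ⟨hne.symm, ?_⟩
  have hi : a - a / 400 ≤ nearestDist y i :=
    le_nearestDist_of_mem hs ha hh hsep hz hj (by rw [dist_self]; linarith)
  have hjw : a - a / 400 ≤ nearestDist y (jOf w) :=
    le_nearestDist_of_mem hs ha hh hsep hz hj (by linarith)
  have hmin := le_min hi hjw
  linarith

include hs ha hh hsep hz hj in
/-- **Conversely, a bond at the centre ends at the site of a touching stacking point**: the
stacking point of `j ∈ N(i)` touches `zOf i` (`dist ≤ 1.01 · 1.0025·a`, so the stacking points
are `< √2·a` apart), and `j` is its site. [folklore] -/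
theorem zOf_touching_of_mem {j : ι} (hjN : j ∈ (bondGraph (1 / 100 : ℝ) y).neighborSet i) :
    (zOf j ∈ barlowStacking a h s ∧ dist (zOf i) (zOf j) = a) ∧ jOf (zOf j) = j := by
  rw [mem_neighborSet_bondGraph] at hjN
  obtain ⟨hne, hle⟩ := hjN
  have hnn : nearestDist y i ≤ a + a / 400 :=
    nearestDist_le_of_mem hs ha hh hz hj (by rw [dist_self]; linarith)
  have hd : dist (y i) (y j) ≤ (1 + 1 / 100) * (a + a / 400) :=
    hle.trans (mul_le_mul_of_nonneg_left ((min_le_left _ _).trans hnn) (by norm_num))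
  have hib : dist (y i) (y i) ≤ 6 * a := by rw [dist_self]; linarith
  have hj6 : dist (y i) (y j) ≤ 6 * a := by linarith
  obtain ⟨hzS, hzj⟩ := hz j hj6
  obtain ⟨hziS, hzi⟩ := hz i hib
  refine ⟨⟨hzS, ?_⟩, jOf_zOf ha hsep hz hj (by linarith)⟩
  have hlt : dist (zOf i) (zOf j) < Real.sqrt 2 * a := by
    rw [← g.dist_map]
    have h1 := dist_triangle_left (g (zOf i)) (g (zOf j)) (y i)
    have h2 := dist_triangle (y i) (y j) (g (zOf j))
    have hs2 : (141 / 100 : ℝ) * a < Real.sqrt 2 * a :=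
      mul_lt_mul_of_pos_right (Real.lt_sqrt_of_sq_lt (by norm_num)) ha
    linarith
  rcases eq_or_dist_eq_of_dist_lt hs ha hh hziS hzS hlt with heq | hdist
  · refine absurd (eq_of_dist_lt_half hsep hib hj6 ?_) hne
    rw [heq] at hzi
    have := dist_triangle_right (y i) (y j) (g (zOf j)); linarith
  · exact hdist

include hs ha hh hsep hz hj in
/-- **The neighbour set of the centre**: the sites of the twelve touching stacking points.
[folklore] -/
theorem neighborSet_eq :
    (bondGraph (1 / 100 : ℝ) y).neighborSet i =
      jOf '' {w | w ∈ barlowStacking a h s ∧ dist (zOf i) w = a} := by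
  ext j
  refine ⟨fun hjN => ?_, ?_⟩
  · obtain ⟨hT, hjj⟩ := zOf_touching_of_mem hs ha hh hsep hz hj hjN
    exact ⟨zOf j, hT, hjj⟩
  · rintro ⟨w, ⟨hwS, hw⟩, rfl⟩
    exact jOf_mem_neighborSet hs ha hh hsep hz hj hwS hw

include hs ha hh hsep hz hj in
/-- **The common neighbours of the centre and the site of a touching stacking point `w`**: the
sites of the stacking points touching both `zOf i` and `w`. [folklore] -/
theorem inter_eq {w : EuclideanSpace ℝ (Fin 3)} (hwS : w ∈ barlowStacking a h s)
    (hw : dist (zOf i) w = a) :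
    (bondGraph (1 / 100 : ℝ) y).neighborSet i ∩ (bondGraph (1 / 100 : ℝ) y).neighborSet (jOf w) =
      jOf '' {w' | w' ∈ barlowStacking a h s ∧ dist (zOf i) w' = a ∧ dist w w' = a} := by
  obtain ⟨-, hjw, hij, hne⟩ := touching_site ha hz hj hwS hw
  ext k
  constructor
  · rintro ⟨hki, hkj⟩
    obtain ⟨⟨hzS, hzk⟩, hkk⟩ := zOf_touching_of_mem hs ha hh hsep hz hj hki
    refine ⟨zOf k, ⟨hzS, hzk, ?_⟩, hkk⟩
    rw [mem_neighborSet_bondGraph] at hkj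
    obtain ⟨hne', hle⟩ := hkj
    have hnnj : nearestDist y (jOf w) ≤ a + a / 400 := by
      have := nearestDist_le_dist y (j := jOf w) hne.symm
      rw [dist_comm] at this
      linarith
    have hd : dist (y (jOf w)) (y k) ≤ (1 + 1 / 100) * (a + a / 400) :=
      hle.trans (mul_le_mul_of_nonneg_left ((min_le_left _ _).trans hnnj) (by norm_num))
    obtain ⟨-, hkz, -⟩ := touching_site ha hz hj hzS hzk
    rw [hkk] at hkz
    have hlt : dist w (zOf k) < Real.sqrt 2 * a := by
      rw [← g.dist_map]
      have h1 := dist_triangle_left (g w) (g (zOf k)) (y (jOf w))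
      have h2 := dist_triangle (y (jOf w)) (y k) (g (zOf k))
      have hs2 : (141 / 100 : ℝ) * a < Real.sqrt 2 * a :=
        mul_lt_mul_of_pos_right (Real.lt_sqrt_of_sq_lt (by norm_num)) ha
      linarith
    rcases eq_or_dist_eq_of_dist_lt hs ha hh hwS hzS hlt with heq | hdist
    · exact absurd (by rw [← hkk, ← heq]) hne'
    · exact hdist
  · rintro ⟨w', ⟨hw'S, hw'1, hw'2⟩, rfl⟩
    refine ⟨jOf_mem_neighborSet hs ha hh hsep hz hj hw'S hw'1, ?_⟩
    rw [mem_neighborSet_bondGraph]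
    obtain ⟨-, hjw', hij', -⟩ := touching_site ha hz hj hw'S hw'1
    constructor
    · intro heq
      have := injOn_jOf hs ha hh hz hj ⟨hwS, hw⟩ ⟨hw'S, hw'1⟩ heq
      rw [this, dist_self] at hw'2
      exact ha.ne hw'2
    · have hmin : a - a / 400 ≤ min (nearestDist y (jOf w)) (nearestDist y (jOf w')) :=
        le_min (le_nearestDist_of_mem hs ha hh hsep hz hj (by linarith))
          (le_nearestDist_of_mem hs ha hh hsep hz hj (by linarith))
      have h1 := dist_triangle (y (jOf w)) (g w) (y (jOf w'))
      have h2 := dist_triangle (g w) (g w') (y (jOf w'))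
      rw [g.dist_map, hw'2] at h2
      linarith [dist_comm (g w') (y (jOf w'))]

include hs ha hh hsep hz hj in
/-- **A matched centre is charge-free at tolerance `1/100`**: twelve bonds (the injective image
of the twelve touching stacking points) and ring number four across each (the image of the four
common touching points). [folklore] -/
theorem isChargeFree_of_matched : IsChargeFree (1 / 100 : ℝ) y i := by
  obtain ⟨hziS, -⟩ := hz i (by rw [dist_self]; linarith)
  have hinj := injOn_jOf hs ha hh hz hj
  refine ⟨?_, fun j hjN => ?_⟩
  · rw [neighborSet_eq hs ha hh hsep hz hj, hinj.ncard_image]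
    exact ncard_touching_eq_twelve hs ha hh hziS
  · obtain ⟨⟨hwS, hw⟩, hjj⟩ := zOf_touching_of_mem hs ha hh hsep hz hj hjN
    have hsub : {w' | w' ∈ barlowStacking a h s ∧ dist (zOf i) w' = a ∧ dist (zOf j) w' = a} ⊆
        {w' | w' ∈ barlowStacking a h s ∧ dist (zOf i) w' = a} :=
      fun w' hw' => ⟨hw'.1, hw'.2.1⟩
    rw [← hjj, ringNumber_def, inter_eq hs ha hh hsep hz hj hwS hw,
      (hinj.mono hsub).ncard_image]
    exact ncard_commonTouching_eq_four hs ha hh hziS hwS hw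

include hs ha hh hsep hz hj in
/-- **No threshold pair near a matched centre**: two distinct sites within `3 · nn_i` of the
centre are never exactly at the bond threshold `dist = 1.01 · min (nn, nn)` — their distance is
`≤ 1.0025·a` or `≥ √2·a − 0.0025·a`, while the threshold lies in
`[1.01 · 0.9975, 1.01 · 1.0025]·a`. [folklore] -/
theorem not_threshold :
    ¬ ∃ p p' : ι, p ≠ p' ∧ dist (y p) (y i) ≤ 3 * nearestDist y i ∧
      dist (y p') (y i) ≤ 3 * nearestDist y i ∧
      dist (y p) (y p') = (1 + 1 / 100) * min (nearestDist y p) (nearestDist y p') := by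
  rintro ⟨p, p', hne, hp, hp', heq⟩
  have hnn : nearestDist y i ≤ a + a / 400 :=
    nearestDist_le_of_mem hs ha hh hz hj (by rw [dist_self]; linarith)
  rw [dist_comm] at hp hp'
  have hp4 : dist (y i) (y p) ≤ 4 * a := by linarith
  have hp4' : dist (y i) (y p') ≤ 4 * a := by linarith
  have hlo : a - a / 400 ≤ min (nearestDist y p) (nearestDist y p') :=
    le_min (le_nearestDist_of_mem hs ha hh hsep hz hj hp4)
      (le_nearestDist_of_mem hs ha hh hsep hz hj hp4')
  have hhi : min (nearestDist y p) (nearestDist y p') ≤ a + a / 400 :=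
    (min_le_left _ _).trans (nearestDist_le_of_mem hs ha hh hz hj hp4)
  have hs2 : (141 / 100 : ℝ) * a < Real.sqrt 2 * a :=
    mul_lt_mul_of_pos_right (Real.lt_sqrt_of_sq_lt (by norm_num)) ha
  rcases dist_le_or_le hs ha hh hsep hz hne (by linarith) (by linarith) with h1 | h1
  · linarith
  · linarith

end Matching

/-- **Margin lemma** (line `defect-zoom-compactness` of `ChargedEnergyGap`, stub
`stub_barlowMargin`): if `Y ∋ 0` is two-way `a/800`-matched on `‖·‖ ≤ 6a` to a rigid image of an
ideal close-packed Barlow stacking `barlowStacking a (a√(2/3)) s` (any Hägg sequence `s`) and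
`a/2`-separated there, then `0` is charge-free in `Y` at tolerance `1/100` and no two points of
`Y` within `3 · nn_0` of `0` sit exactly at the bond threshold. [folklore] -/
theorem stub_barlowMargin : ∀ (Y : Set (EuclideanSpace ℝ (Fin 3))) (h0 : (0 : EuclideanSpace ℝ (Fin 3)) ∈ Y), (∃ a : ℝ, 0 < a ∧ ∃ s : ℤ → ℤ, Literature.MathematicalPhysics.StatisticalMechanics.IsHaggSeq s ∧ ∃ g : EuclideanSpace ℝ (Fin 3) ≃ᵃⁱ[ℝ] EuclideanSpace ℝ (Fin 3), Literature.MathematicalPhysics.StatisticalMechanics.BallMatch (a / 800) (6 * a) 0 Y (g '' Literature.MathematicalPhysics.StatisticalMechanics.barlowStacking a (a * Real.sqrt (2 / 3)) s) ∧ ∀ p ∈ Y, ∀ q ∈ Y, ‖p‖ ≤ 6 * a → ‖q‖ ≤ 6 * a → p ≠ q → a / 2 ≤ dist p q) → ¬ (¬ Literature.Geometry.DiscreteGeometry.IsChargeFree (1 / 100 : ℝ) (Subtype.val : ↥Y → EuclideanSpace ℝ (Fin 3)) (⟨0, h0⟩ : ↥Y) ∨ ∃ p p' : ↥Y, p ≠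 p' ∧ dist (p : EuclideanSpace ℝ (Fin 3)) (⟨0, h0⟩ : ↥Y) ≤ 3 * Literature.Geometry.DiscreteGeometry.nearestDist (Subtype.val : ↥Y → EuclideanSpace ℝ (Fin 3)) (⟨0, h0⟩ : ↥Y) ∧ dist (p' : EuclideanSpace ℝ (Fin 3)) (⟨0, h0⟩ : ↥Y) ≤ 3 * Literature.Geometry.DiscreteGeometry.nearestDist (Subtype.val : ↥Y → EuclideanSpace ℝ (Fin 3)) (⟨0, h0⟩ : ↥Y) ∧ dist (p : EuclideanSpace ℝ (Fin 3)) p' = (1 + 1 / 100) * min (Literature.Geometry.DiscreteGeometry.nearestDist (Subtype.val : ↥Y → EuclideanSpace ℝ (Fin 3)) p) (Literature.Geometry.DiscreteGeometry.nearestDist (Subtype.val : ↥Y → EuclideanSpace ℝ (Fin 3)) p')) := by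
  intro Y h0 hyp
  obtain ⟨a, ha, s, hs, g, hBM, hsep⟩ := hyp
  have hh : (a * Real.sqrt (2 / 3)) ^ 2 = 2 / 3 * a ^ 2 := by
    rw [mul_pow, Real.sq_sqrt (by norm_num : (0 : ℝ) ≤ 2 / 3)]; ring
  have h₁ : ∀ j : ↥Y, ∃ z : EuclideanSpace ℝ (Fin 3),
      dist (0 : EuclideanSpace ℝ (Fin 3)) j.1 ≤ 6 * a →
        z ∈ barlowStacking a (a * Real.sqrt (2 / 3)) s ∧ dist j.1 (g z) ≤ a / 800 := fun j => by
    by_cases hjb : dist (0 : EuclideanSpace ℝ (Fin 3)) j.1 ≤ 6 * a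
    · obtain ⟨_, ⟨z, hzB, rfl⟩, hd⟩ := hBM.2 j.1 j.2 (by rwa [dist_comm] at hjb)
      exact ⟨z, fun _ => ⟨hzB, hd⟩⟩
    · exact ⟨0, fun h' => absurd h' hjb⟩
  have h₂ : ∀ z : EuclideanSpace ℝ (Fin 3), ∃ j : ↥Y,
      z ∈ barlowStacking a (a * Real.sqrt (2 / 3)) s →
        dist (0 : EuclideanSpace ℝ (Fin 3)) (g z) ≤ 6 * a → dist j.1 (g z) ≤ a / 800 := fun z => by
    by_cases hzb : z ∈ barlowStacking a (a * Real.sqrt (2 / 3)) s ∧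
        dist (0 : EuclideanSpace ℝ (Fin 3)) (g z) ≤ 6 * a
    · obtain ⟨p, hpY, hd⟩ := hBM.1 (g z) ⟨z, hzb.1, rfl⟩ (by rw [dist_comm]; exact hzb.2)
      exact ⟨⟨p, hpY⟩, fun _ _ => hd⟩
    · exact ⟨⟨0, h0⟩, fun h1 h2 => absurd ⟨h1, h2⟩ hzb⟩
  choose zOf hzOf using h₁
  choose jOf hjOf using h₂
  have hsep' : ∀ j k : ↥Y, j ≠ k → dist (0 : EuclideanSpace ℝ (Fin 3)) j.1 ≤ 6 * a →
      dist (0 : EuclideanSpace ℝ (Fin 3)) k.1 ≤ 6 * a → a / 2 ≤ dist j.1 k.1 :=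
    fun j k hne hjb hkb => hsep j.1 j.2 k.1 k.2 (by rwa [dist_comm, dist_zero_right] at hjb)
      (by rwa [dist_comm, dist_zero_right] at hkb) (fun heq => hne (Subtype.ext heq))
  have hcf := isChargeFree_of_matched (y := Subtype.val) (i := ⟨0, h0⟩) hs ha hh hsep' hzOf hjOf
  have hth := not_threshold (y := Subtype.val) (i := ⟨0, h0⟩) hs ha hh hsep' hzOf hjOf
  rintro (h | h)
  · exact h hcf
  · exact hth h

end Summit.AtomisticToContinuum.Crystallization.Theorems.DefectZoomCompactnessBarlowMargin
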